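import Summits.RiemannHypothesis.RiemannHypothesis.Theorems.Splittings.NbPlateauLockReal
import HarnessLib

/-!
# RH-EQUIVALENT·SPLITTING CENSUS (nb, neg) · V37 «PLATEAU / BUDGET-FREE MÖBIUS LOCK» (file 3 of 3: the lock for ARBITRARY COMPLEX coefficient vectors of the E_NB route functional — `I(N,a) ≤ i ⇒ ‖a_j − μ(j+1)‖ ≤ 6 σ₁(j+1) √(i/π)` — and the census consequences: the budget-FREE OFF-MÖBIUS conjunct is REFUTED, explicit length / index-free / counting-sparse floors); nothing here bears on the truth of RH

LABEL (line 1): RH-EQUIVALENT·SPLITTING (cell `rh-split`, seat (nb, neg), generation 12, census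
candidate V37, file 3 of 3).  Zero definitions; standard axioms; imports file 2
(`Splittings.NbPlateauLockReal`).  Same namespace as files 1–2.

## Results (route functional `I(N, a)`, `a : Fin N → ℂ` ARBITRARY — no budget, no sign, no zero of ζ)

* `norm_coeff_sub_moebius_le_of_lintegral_le` (+ primed `Fin`-free form): THE LOCK
  `I(N,a) ≤ i ⇒ ‖a_j − μ(j+1)‖ ≤ 6 σ₁(j+1) √(i/π)` (real lock for `Re a` and for
  `Re a + 2y Im a = w a + w̄ ā`, `w = ½ − iy`, every `y > 0`; then `y → ∞`);
* `nbMoebiusLockFree` : generation 11's lock law WITHOUT the budget `‖a‖_∞ ≤ M`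
  (`ε = π η²/(36 σ₁(j+1)²)`);
* `not_nbCoeffOffMoebiusApprox` : the conjunct «approximants keeping `‖a_j − μ(j+1)‖ ≥ δ`» is
  FALSE for every `j`, `δ > 0` (generation 11's V36d, budget removed) — REFUTED-CONJUNCT, splitting
  idle (`nbThesis_of_nbCoeffOffMoebiusApprox` is the read-back that it strengthened `NbThesis`);
* `nb_lintegral_ge_length_floor` : `I(N,a) ≥ 2π/(6(2N+1))²` for EVERY `N`, `a` (zero-free,
  explicit; the printed zero-free laws are the sharper asymptotic `≥ c/log N`);
* `nb_lintegral_ge_of_index_free` / `_of_prime_index_free` / `_of_coeff_eq_zero` : a squarefree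
  Dirichlet index `n` carrying no coefficient forces `I(N,a) ≥ 2π/(6 σ₁(n))²` — every support
  pattern missing a squarefree index is a refuted conjunct with an explicit floor (structured
  sparsity, generation 10's question (R5), refuted side);
* `nb_lintegral_ge_of_card_support_le` : at most `B` non-zero coefficients force
  `I(N,a) ≥ 2π/(6(P+1))²`, `P = Nat.nth Nat.Prime B`, uniformly in `N` (generation 10's question
  (R2): the explicit `ε(B)`).

HONEST LABEL: «SPLITTING SEARCH over kernel-typed RH-EQUIVALENCES; a splitting A ∧ B ⟹ RH is
CONDITIONAL bookkeeping unless A and B are both proved; nothing here bears on the truth of RH.»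
-/

set_option linter.dupNamespace false

namespace Summit.RiemannHypothesis.RiemannHypothesis.Theorems.Splittings.NbPlateauLock

open MeasureTheory Set Finset
open scoped ArithmeticFunction.Moebius ArithmeticFunction.zeta ComplexConjugate
open Literature.NumberTheory.LFunctions
open Summit.RiemannHypothesis.RiemannHypothesis.Theorems.NbTheory (nbDistSq)
open Summit.RiemannHypothesis.RiemannHypothesis.Theorems.Splittings.NbLevelCertificate

/-! ## 7. THE LOCK for COMPLEX coefficient vectors (route functional `I(N, a)`) -/

open ArithmeticFunction in
/-- `n ≤ σ₁(n)` for `n ≠ 0` (so `σ₁(n) ≥ 1`). -/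
theorem self_le_sigma_one {n : ℕ} (hn : n ≠ 0) : n ≤ sigma 1 n := by
  rw [sigma_one_apply]
  exact Finset.single_le_sum (f := fun d ↦ d) (fun _ _ ↦ Nat.zero_le _) (Nat.mem_divisors_self _ hn)

open ArithmeticFunction in
/-- **THE PLATEAU LOCK (route functional, arbitrary complex coefficients; NO budget, NO zero of ζ).**
If `I(N, a) ≤ i` then `‖a_j − μ(j+1)‖ ≤ 6 σ₁(j+1) √(i/π)` for every `j < N`.  Proof: the real lock
for `Re a` (via the landed `I(Re a) ≤ I(a)`) and for `Re a + 2y·Im a = w a + w̄ ā`, `w = ½ − iy`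
(via `I ≤ (1+4y²) i`), for every `y > 0`; then `y → ∞`. -/
theorem norm_coeff_sub_moebius_le_of_lintegral_le {N : ℕ} (a : Fin N → ℂ) {i : ℝ} (hi : 0 ≤ i)
    (hI : ∫⁻ t : ℝ, ENNReal.ofReal (‖1 - riemannZeta (1 / 2 + t * Complex.I) *
        ∑ n : Fin N, a n * ((n : ℂ) + 1) ^ (-(1 / 2 + t * Complex.I))‖ ^ 2 / (1 / 4 + t ^ 2)) ≤
      ENNReal.ofReal i) (j : Fin N) :
    ‖a j - (μ ((j : ℕ) + 1) : ℂ)‖ ≤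
      6 * ((sigma 1 ((j : ℕ) + 1) : ℕ) : ℝ) * Real.sqrt (i / Real.pi) := by
  have hσ0 : 0 ≤ ((sigma 1 ((j : ℕ) + 1) : ℕ) : ℝ) := by positivity
  have hS0 : 0 ≤ Real.sqrt (i / (2 * Real.pi)) := Real.sqrt_nonneg _
  -- Step 1: the real part.
  have hre : |(a j).re - (μ ((j : ℕ) + 1) : ℝ)| ≤
      6 * ((sigma 1 ((j : ℕ) + 1) : ℕ) : ℝ) * Real.sqrt (i / (2 * Real.pi)) :=
    abs_realCoeff_sub_moebius_le_of_lintegral_le N (fun n ↦ (a n).re) hi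
      ((NbCoefficientSign.nb_lintegral_re_le a).trans hI) j
  -- Step 2: the imaginary part, for every auxiliary `y > 0`.
  have him_y : ∀ y : ℝ, 0 < y → |(a j).im| ≤
      6 * ((sigma 1 ((j : ℕ) + 1) : ℕ) : ℝ) * Real.sqrt (i / (2 * Real.pi)) +
        6 * ((sigma 1 ((j : ℕ) + 1) : ℕ) : ℝ) * Real.sqrt (i / (2 * Real.pi)) / y := by
    intro y hy
    have hwc : conj ((1 / 2 : ℂ) - (y : ℂ) * Complex.I) = (1 / 2 : ℂ) + (y : ℂ) * Complex.I := by
      apply Complex.ext <;> simp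
    have hw1 : ((1 / 2 : ℂ) - (y : ℂ) * Complex.I) + conj ((1 / 2 : ℂ) - (y : ℂ) * Complex.I) = 1 := by
      rw [hwc]; ring
    have hwn : ‖(1 / 2 : ℂ) - (y : ℂ) * Complex.I‖ ^ 2 = 1 / 4 + y ^ 2 := by
      rw [Complex.sq_norm, Complex.normSq_apply]
      simp
      ring
    have hb : ∀ n : Fin N, ((1 / 2 : ℂ) - (y : ℂ) * Complex.I) * a n +
        conj ((1 / 2 : ℂ) - (y : ℂ) * Complex.I) * conj (a n) =
        (((a n).re + 2 * y * (a n).im : ℝ) : ℂ) := by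
      intro n
      rw [hwc]
      apply Complex.ext
      · simp; ring
      · simp; ring
    have htw := nb_lintegral_twist_le a _ hw1
    simp_rw [hb] at htw
    have hI' : ∫⁻ t : ℝ, ENNReal.ofReal (‖1 - riemannZeta (1 / 2 + t * Complex.I) *
        ∑ n : Fin N, (((a n).re + 2 * y * (a n).im : ℝ) : ℂ) * ((n : ℂ) + 1) ^ (-(1 / 2 + t * Complex.I))‖ ^ 2 /
        (1 / 4 + t ^ 2)) ≤ ENNReal.ofReal ((1 + 4 * y ^ 2) * i) := by
      refine htw.trans ?_
      rw [hwn, show (1 + 4 * y ^ 2) * i = (4 * (1 / 4 + y ^ 2)) * i by ring,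
        ENNReal.ofReal_mul (by positivity : (0 : ℝ) ≤ 4 * (1 / 4 + y ^ 2))]
      exact mul_le_mul' le_rfl hI
    have hlock := abs_realCoeff_sub_moebius_le_of_lintegral_le N
      (fun n ↦ (a n).re + 2 * y * (a n).im) (by positivity) hI' j
    have hsq : Real.sqrt ((1 + 4 * y ^ 2) * i / (2 * Real.pi)) ≤
        (1 + 2 * y) * Real.sqrt (i / (2 * Real.pi)) := by
      rw [mul_div_assoc, Real.sqrt_mul (by positivity)]
      refine mul_le_mul_of_nonneg_right ?_ (Real.sqrt_nonneg _)
      rw [Real.sqrt_le_left (by positivity)]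
      nlinarith
    have h1 : |((a j).re + 2 * y * (a j).im) - (μ ((j : ℕ) + 1) : ℝ)| ≤
        6 * ((sigma 1 ((j : ℕ) + 1) : ℕ) : ℝ) * ((1 + 2 * y) * Real.sqrt (i / (2 * Real.pi))) :=
      hlock.trans (mul_le_mul_of_nonneg_left hsq (by positivity))
    have h2 : |2 * y * (a j).im| ≤
        6 * ((sigma 1 ((j : ℕ) + 1) : ℕ) : ℝ) * ((1 + 2 * y) * Real.sqrt (i / (2 * Real.pi))) +
          6 * ((sigma 1 ((j : ℕ) + 1) : ℕ) : ℝ) * Real.sqrt (i / (2 * Real.pi)) := by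
      have e : 2 * y * (a j).im = (((a j).re + 2 * y * (a j).im) - (μ ((j : ℕ) + 1) : ℝ)) -
          ((a j).re - (μ ((j : ℕ) + 1) : ℝ)) := by ring
      rw [e]
      exact (abs_sub _ _).trans (add_le_add h1 hre)
    rw [abs_mul, abs_of_pos (by positivity : (0 : ℝ) < 2 * y)] at h2
    rw [← sub_le_iff_le_add', le_div_iff₀ hy]
    nlinarith [h2]
  -- Step 3: `y → ∞`.
  have him : |(a j).im| ≤ 6 * ((sigma 1 ((j : ℕ) + 1) : ℕ) : ℝ) * Real.sqrt (i / (2 * Real.pi)) := by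
    refine le_of_forall_pos_le_add fun ε hε ↦ ?_
    have hA0 : 0 ≤ 6 * ((sigma 1 ((j : ℕ) + 1) : ℕ) : ℝ) * Real.sqrt (i / (2 * Real.pi)) := by
      positivity
    have hy : 0 < (6 * ((sigma 1 ((j : ℕ) + 1) : ℕ) : ℝ) * Real.sqrt (i / (2 * Real.pi)) + 1) / ε := by
      positivity
    refine (him_y _ hy).trans (add_le_add le_rfl ?_)
    rw [div_div_eq_mul_div, div_le_iff₀ (by positivity)]
    nlinarith
  -- Step 4: combine real and imaginary parts.
  have hT0 : 0 ≤ 6 * ((sigma 1 ((j : ℕ) + 1) : ℕ) : ℝ) * Real.sqrt (i / Real.pi) := by positivity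
  refine (pow_le_pow_iff_left₀ (norm_nonneg _) hT0 two_ne_zero).mp ?_
  have hre' : (a j - (μ ((j : ℕ) + 1) : ℂ)).re = (a j).re - (μ ((j : ℕ) + 1) : ℝ) := by simp
  have him' : (a j - (μ ((j : ℕ) + 1) : ℂ)).im = (a j).im := by simp
  have h3 := pow_le_pow_left₀ (abs_nonneg _) hre 2
  have h4 := pow_le_pow_left₀ (abs_nonneg _) him 2
  rw [sq_abs] at h3 h4
  rw [Complex.sq_norm, Complex.normSq_apply, hre', him', mul_pow, mul_pow,
    Real.sq_sqrt (by positivity : (0 : ℝ) ≤ i / Real.pi)]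
  rw [mul_pow, mul_pow, Real.sq_sqrt (by positivity : (0 : ℝ) ≤ i / (2 * Real.pi))] at h3 h4
  have e : i / Real.pi = 2 * (i / (2 * Real.pi)) := by
    field_simp
  rw [e]
  nlinarith [h3, h4]

open ArithmeticFunction in
/-- The lock, `Fin`-free indexing: `‖a_j − μ(j+1)‖ ≤ 6 σ₁(j+1) √(i/π)` for `j < N`. -/
theorem norm_coeff_sub_moebius_le_of_lintegral_le' {N : ℕ} (a : Fin N → ℂ) {i : ℝ} (hi : 0 ≤ i)
    (hI : ∫⁻ t : ℝ, ENNReal.ofReal (‖1 - riemannZeta (1 / 2 + t * Complex.I) *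
        ∑ n : Fin N, a n * ((n : ℂ) + 1) ^ (-(1 / 2 + t * Complex.I))‖ ^ 2 / (1 / 4 + t ^ 2)) ≤
      ENNReal.ofReal i) {j : ℕ} (hj : j < N) :
    ‖a ⟨j, hj⟩ - (μ (j + 1) : ℂ)‖ ≤ 6 * ((sigma 1 (j + 1) : ℕ) : ℝ) * Real.sqrt (i / Real.pi) :=
  norm_coeff_sub_moebius_le_of_lintegral_le a hi hI ⟨j, hj⟩

open ArithmeticFunction in
/-- **BUDGET-FREE MÖBIUS LOCK LAW** (generation 11's `NbMoebiusLock.nbMoebiusLock` WITHOUT the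
coefficient budget `‖a‖_∞ ≤ M`): for every index `j` and tolerance `η > 0` the explicit
`ε = π η²/(36 σ₁(j+1)²) > 0` is such that EVERY E_NB-approximant with `I(N, a) ≤ ε` (any `N > j`,
any complex coefficients) has `‖a_j − μ(j+1)‖ ≤ η`. -/
theorem nbMoebiusLockFree (j : ℕ) (η : ℝ) (hη : 0 < η) :
    ∃ ε : ℝ, 0 < ε ∧ ∀ (N : ℕ) (a : Fin N → ℂ) (hj : j < N),
      ∫⁻ t : ℝ, ENNReal.ofReal (‖1 - riemannZeta (1 / 2 + t * Complex.I) *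
        ∑ n : Fin N, a n * ((n : ℂ) + 1) ^ (-(1 / 2 + t * Complex.I))‖ ^ 2 / (1 / 4 + t ^ 2)) ≤
      ENNReal.ofReal ε → ‖a ⟨j, hj⟩ - (μ (j + 1) : ℂ)‖ ≤ η := by
  have hσ : 0 < ((sigma 1 (j + 1) : ℕ) : ℝ) := by
    exact_mod_cast lt_of_lt_of_le (Nat.succ_pos j) (self_le_sigma_one (Nat.succ_ne_zero j))
  refine ⟨Real.pi * η ^ 2 / (36 * ((sigma 1 (j + 1) : ℕ) : ℝ) ^ 2), by positivity,
    fun N a hj hI ↦ ?_⟩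
  refine (norm_coeff_sub_moebius_le_of_lintegral_le' a (by positivity) hI hj).trans (le_of_eq ?_)
  have e : Real.pi * η ^ 2 / (36 * ((sigma 1 (j + 1) : ℕ) : ℝ) ^ 2) / Real.pi =
      (η / (6 * ((sigma 1 (j + 1) : ℕ) : ℝ))) ^ 2 := by
    field_simp
    norm_num
  rw [e, Real.sqrt_sq (by positivity)]
  field_simp

/-! ## 8. Census consequences (the budget-free OFF-MÖBIUS conjunct is REFUTED; explicit floors) -/

open ArithmeticFunction in
/-- **V36d / V37 REFUTED CONJUNCT (budget-FREE, zero-free, effective).**  For every index `j` and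
every `δ > 0` there is NO family of E_NB-approximants keeping `‖a_j − μ(j+1)‖ ≥ δ`: the conjunct
«`∀ ε > 0 ∃ N ∃ a, δ ≤ ‖a_j − μ(j+1)‖ ∧ I(N,a) < ε`» is FALSE (take `ε = π δ²/(72 σ₁(j+1)²)`).
This removes the coefficient budget `‖a‖_∞ ≤ M` from generation 11's `not_nbCoeffOffMoebiusBddApprox`. -/
theorem not_nbCoeffOffMoebiusApprox (j : ℕ) (δ : ℝ) (hδ : 0 < δ) :
    ¬ (∀ ε : ℝ, 0 < ε → ∃ (N : ℕ) (a : Fin N → ℂ) (hj : j < N),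
      δ ≤ ‖a ⟨j, hj⟩ - (μ (j + 1) : ℂ)‖ ∧
      ∫⁻ t : ℝ, ENNReal.ofReal (‖1 - riemannZeta (1 / 2 + t * Complex.I) *
        ∑ n : Fin N, a n * ((n : ℂ) + 1) ^ (-(1 / 2 + t * Complex.I))‖ ^ 2 / (1 / 4 + t ^ 2)) <
      ENNReal.ofReal ε) := by
  intro h
  have hσ1 : (1 : ℝ) ≤ ((sigma 1 (j + 1) : ℕ) : ℝ) := by
    exact_mod_cast le_trans (by omega : 1 ≤ j + 1) (self_le_sigma_one (Nat.succ_ne_zero j))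
  set ε : ℝ := Real.pi * δ ^ 2 / (72 * ((sigma 1 (j + 1) : ℕ) : ℝ) ^ 2) with hε
  have hε0 : 0 < ε := by positivity
  obtain ⟨N, a, hj, hδa, hlt⟩ := h ε hε0
  have hlock := norm_coeff_sub_moebius_le_of_lintegral_le' a hε0.le hlt.le hj
  have hX : (6 * ((sigma 1 (j + 1) : ℕ) : ℝ) * Real.sqrt (ε / Real.pi)) ^ 2 = δ ^ 2 / 2 := by
    rw [mul_pow, mul_pow, Real.sq_sqrt (by positivity), hε]
    field_simp
    ring
  have h2 := pow_le_pow_left₀ hδ.le (hδa.trans hlock) 2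
  rw [hX] at h2
  nlinarith

/-- Read-back: the refuted conjunct is a literal strengthening of the route functional's thesis
`NbThesis` (forget the off-Möbius constraint), so the splitting `NbThesis ∧ (conjunct) ⟹ RH` was
idle bookkeeping — and is now vacuous. -/
theorem nbThesis_of_nbCoeffOffMoebiusApprox (j : ℕ) (δ : ℝ)
    (h : ∀ ε : ℝ, 0 < ε → ∃ (N : ℕ) (a : Fin N → ℂ) (hj : j < N),
      δ ≤ ‖a ⟨j, hj⟩ - ((ArithmeticFunction.moebius (j + 1) : ℤ) : ℂ)‖ ∧
      ∫⁻ t : ℝ, ENNReal.ofReal (‖1 - riemannZeta (1 / 2 + t * Complex.I) *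
        ∑ n : Fin N, a n * ((n : ℂ) + 1) ^ (-(1 / 2 + t * Complex.I))‖ ^ 2 / (1 / 4 + t ^ 2)) <
      ENNReal.ofReal ε) :
    Summit.RiemannHypothesis.RiemannHypothesis.Theses.NymanBeurling.NbThesis := fun ε hε ↦ by
  obtain ⟨N, a, _, _, hlt⟩ := h ε hε
  exact ⟨N, a, hlt⟩

/-- Elementary: `1 ≤ c √(x/(2π))` with `c > 0`, `x ≥ 0` forces `x ≥ 2π/c²`. -/
theorem two_pi_div_sq_le_of_one_le {c x : ℝ} (hc : 0 < c) (hx : 0 ≤ x)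
    (h : 1 ≤ c * Real.sqrt (x / (2 * Real.pi))) : 2 * Real.pi / c ^ 2 ≤ x := by
  have h1 : 1 / c ≤ Real.sqrt (x / (2 * Real.pi)) := by
    rw [div_le_iff₀' hc]; exact h
  have h2 : (1 / c) ^ 2 ≤ x / (2 * Real.pi) := by
    have := pow_le_pow_left₀ (by positivity) h1 2
    rwa [Real.sq_sqrt (by positivity)] at this
  rw [le_div_iff₀ (by positivity)] at h2
  calc 2 * Real.pi / c ^ 2 = (1 / c) ^ 2 * (2 * Real.pi) := by field_simp
    _ ≤ x := h2

/-- From a real floor valid under every real upper bound to an `ENNReal` floor of the route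
functional. -/
theorem ofReal_le_nb_lintegral_of_forall {N : ℕ} (a : Fin N → ℂ) {L : ℝ}
    (h : ∀ i : ℝ, 0 ≤ i → ∫⁻ t : ℝ, ENNReal.ofReal (‖1 - riemannZeta (1 / 2 + t * Complex.I) *
        ∑ n : Fin N, a n * ((n : ℂ) + 1) ^ (-(1 / 2 + t * Complex.I))‖ ^ 2 / (1 / 4 + t ^ 2)) ≤
      ENNReal.ofReal i → L ≤ i) :
    ENNReal.ofReal L ≤ ∫⁻ t : ℝ, ENNReal.ofReal (‖1 - riemannZeta (1 / 2 + t * Complex.I) *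
        ∑ n : Fin N, a n * ((n : ℂ) + 1) ^ (-(1 / 2 + t * Complex.I))‖ ^ 2 / (1 / 4 + t ^ 2)) := by
  by_cases htop : ∫⁻ t : ℝ, ENNReal.ofReal (‖1 - riemannZeta (1 / 2 + t * Complex.I) *
        ∑ n : Fin N, a n * ((n : ℂ) + 1) ^ (-(1 / 2 + t * Complex.I))‖ ^ 2 / (1 / 4 + t ^ 2)) = ⊤
  · rw [htop]; exact le_top
  · calc ENNReal.ofReal L ≤ ENNReal.ofReal _ :=
          ENNReal.ofReal_le_ofReal (h _ ENNReal.toReal_nonneg (ENNReal.ofReal_toReal htop).ge)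
      _ = _ := ENNReal.ofReal_toReal htop

open ArithmeticFunction in
/-- **ZERO-FREE LENGTH LAW (arbitrary complex coefficients).** For EVERY `N` and EVERY
`a : Fin N → ℂ`:  `I(N, a) ≥ 2π/(6(2N+1))² = π/(18(2N+1)²)` — the Möbius unit `n ∈ (N, 2N]`
(Bertrand) has no coefficient, and the lock reads `1 = |μ(n)| ≤ 6 σ₁(n) √(I/(2π))`.  No zero of
`ζ`, no budget; the printed zero-free length laws (Báez-Duarte–Balazard–Landreau–Saias 2000,
Burnol 2002) are asymptotic `d_N² ≥ c/log N`; this one is explicit and weaker in rate. -/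
theorem nb_lintegral_ge_length_floor (N : ℕ) (a : Fin N → ℂ) :
    ENNReal.ofReal (2 * Real.pi / (6 * (2 * (N : ℝ) + 1)) ^ 2) ≤
      ∫⁻ t : ℝ, ENNReal.ofReal (‖1 - riemannZeta (1 / 2 + t * Complex.I) *
        ∑ n : Fin N, a n * ((n : ℂ) + 1) ^ (-(1 / 2 + t * Complex.I))‖ ^ 2 / (1 / 4 + t ^ 2)) := by
  refine ofReal_le_nb_lintegral_of_forall a fun i hi hI ↦ ?_
  refine two_pi_div_sq_le_of_one_le (by positivity) hi ?_
  obtain ⟨n, hNn, hμ, hσ⟩ := exists_moebius_unit_beyond N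
  have hre := (NbCoefficientSign.nb_lintegral_re_le a).trans hI
  have h := abs_moebius_le_of_realCoeffFn_eq_zero N (fun n ↦ (a n).re) hi hre (by omega)
    (coeffFn_apply_of_length_lt N _ hNn)
  rw [hμ] at h
  exact h.trans (mul_le_mul_of_nonneg_right (by linarith) (Real.sqrt_nonneg _))

open ArithmeticFunction in
/-- **INDEX-FREE FLOOR (structured sparsity, generation-10 successor question (R5), refuted
side).** If NO coefficient sits at a SQUAREFREE Dirichlet index `n` (`a_j = 0` whenever
`j + 1 = n`; automatic when `n > N`) then `I(N, a) ≥ 2π/(6 σ₁(n))²`, uniformly in `N` and in all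
other coefficients: every support pattern `T ⊆ ℕ` missing a squarefree index is a REFUTED conjunct
with an explicit floor (primes-only supports miss `n = 1`: floor `2π/36`; `{1} ∪ primes` misses
`n = 6`: floor `2π/72²`). -/
theorem nb_lintegral_ge_of_index_free {N : ℕ} (a : Fin N → ℂ) {n : ℕ} (hn : 1 ≤ n)
    (hμ : μ n ≠ 0) (hz : ∀ j : Fin N, (j : ℕ) + 1 = n → a j = 0) :
    ENNReal.ofReal (2 * Real.pi / (6 * ((sigma 1 n : ℕ) : ℝ)) ^ 2) ≤
      ∫⁻ t : ℝ, ENNReal.ofReal (‖1 - riemannZeta (1 / 2 + t * Complex.I) *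
        ∑ n : Fin N, a n * ((n : ℂ) + 1) ^ (-(1 / 2 + t * Complex.I))‖ ^ 2 / (1 / 4 + t ^ 2)) := by
  have hσ : 0 < ((sigma 1 n : ℕ) : ℝ) := by
    exact_mod_cast lt_of_lt_of_le (by omega : 0 < n) (self_le_sigma_one (by omega))
  refine ofReal_le_nb_lintegral_of_forall a fun i hi hI ↦ ?_
  refine two_pi_div_sq_le_of_one_le (by positivity) hi ?_
  have hre := (NbCoefficientSign.nb_lintegral_re_le a).trans hI
  have hsum : (∑ j : Fin N, if (j : ℕ) + 1 = n then (a j).re else 0) = 0 :=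
    Finset.sum_eq_zero fun j _ ↦ by
      by_cases h : (j : ℕ) + 1 = n
      · rw [if_pos h, hz j h, Complex.zero_re]
      · rw [if_neg h]
  have h := abs_moebius_le_of_realCoeffFn_eq_zero N (fun n ↦ (a n).re) hi hre (by omega) hsum
  have h1 : |(μ n : ℝ)| = 1 := by
    rcases moebius_ne_zero_iff_eq_or.mp hμ with h' | h' <;> simp [h']
  rwa [h1] at h

open ArithmeticFunction in
/-- The prime form of the index-free floor: no coefficient at a PRIME index `p` forces
`I(N, a) ≥ 2π/(6(p+1))²`. -/
theorem nb_lintegral_ge_of_prime_index_free {N : ℕ} (a : Fin N → ℂ) {p : ℕ} (hp : p.Prime)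
    (hz : ∀ j : Fin N, (j : ℕ) + 1 = p → a j = 0) :
    ENNReal.ofReal (2 * Real.pi / (6 * ((p : ℝ) + 1)) ^ 2) ≤
      ∫⁻ t : ℝ, ENNReal.ofReal (‖1 - riemannZeta (1 / 2 + t * Complex.I) *
        ∑ n : Fin N, a n * ((n : ℂ) + 1) ^ (-(1 / 2 + t * Complex.I))‖ ^ 2 / (1 / 4 + t ^ 2)) := by
  have h := nb_lintegral_ge_of_index_free a hp.one_lt.le
    (by rw [moebius_apply_prime hp]; norm_num) hz
  have hσ : ((sigma 1 p : ℕ) : ℝ) = (p : ℝ) + 1 := by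
    rw [sigma_one_apply, hp.divisors, Finset.sum_pair hp.one_lt.ne, Nat.cast_add, Nat.cast_one,
      add_comm]
  rwa [hσ] at h

/-- **SPARSE FLOOR at a vanishing coefficient** (`a_{n−1} = 0` at a squarefree `n ≤ N`): the
`Fin`-indexed reading of `nb_lintegral_ge_of_index_free`. -/
theorem nb_lintegral_ge_of_coeff_eq_zero {N : ℕ} (a : Fin N → ℂ) {n : ℕ} (hn : 1 ≤ n) (hnN : n ≤ N)
    (hμ : ArithmeticFunction.moebius n ≠ 0) (h0 : a ⟨n - 1, by omega⟩ = 0) :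
    ENNReal.ofReal (2 * Real.pi / (6 * ((ArithmeticFunction.sigma 1 n : ℕ) : ℝ)) ^ 2) ≤
      ∫⁻ t : ℝ, ENNReal.ofReal (‖1 - riemannZeta (1 / 2 + t * Complex.I) *
        ∑ n : Fin N, a n * ((n : ℂ) + 1) ^ (-(1 / 2 + t * Complex.I))‖ ^ 2 / (1 / 4 + t ^ 2)) := by
  refine nb_lintegral_ge_of_index_free a hn hμ fun j hj ↦ ?_
  have : j = ⟨n - 1, by omega⟩ := Fin.ext (by simp only; omega)
  rw [this, h0]

open ArithmeticFunction in
/-- **COUNTING SPARSE FLOOR, explicit and uniform in the length (closes generation-10's question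
(R2)).** If at most `B` coefficients are non-zero then `I(N, a) ≥ 2π/(6(P+1))²` with
`P = Nat.nth Nat.Prime B` (the `(B+1)`-st prime): among the first `B+1` primes one carries no
coefficient (pigeonhole), and the prime index-free floor applies. -/
theorem nb_lintegral_ge_of_card_support_le {N : ℕ} (a : Fin N → ℂ) (B : ℕ)
    (hB : (Finset.univ.filter (fun n ↦ a n ≠ 0)).card ≤ B) :
    ENNReal.ofReal (2 * Real.pi / (6 * ((Nat.nth Nat.Prime B : ℝ) + 1)) ^ 2) ≤
      ∫⁻ t : ℝ, ENNReal.ofReal (‖1 - riemannZeta (1 / 2 + t * Complex.I) *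
        ∑ n : Fin N, a n * ((n : ℂ) + 1) ^ (-(1 / 2 + t * Complex.I))‖ ^ 2 / (1 / 4 + t ^ 2)) := by
  classical
  -- a prime `q = nth Prime k`, `k ≤ B`, whose index carries no coefficient
  have hex : ∃ k, k ≤ B ∧ ∀ j : Fin N, (j : ℕ) + 1 = Nat.nth Nat.Prime k → a j = 0 := by
    by_contra hall
    push Not at hall
    -- every one of the first `B+1` primes carries a non-zero coefficient: too many
    have hsub : (Finset.range (B + 1)).image (Nat.nth Nat.Prime) ⊆
        (Finset.univ.filter (fun n ↦ a n ≠ 0)).image (fun n : Fin N ↦ (n : ℕ) + 1) := by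
      intro q hq
      obtain ⟨k, hk, rfl⟩ := Finset.mem_image.mp hq
      obtain ⟨j, hj, hne⟩ := hall k (by simpa [Nat.lt_succ_iff] using hk)
      exact Finset.mem_image.mpr ⟨j, Finset.mem_filter.mpr ⟨Finset.mem_univ _, hne⟩, hj⟩
    have hcard := Finset.card_le_card hsub
    rw [Finset.card_image_of_injective _ (Nat.nth_injective Nat.infinite_setOf_prime),
      Finset.card_range] at hcard
    have := hcard.trans (Finset.card_image_le.trans hB)
    omega
  obtain ⟨k, hkB, hk⟩ := hex
  have hprime : (Nat.nth Nat.Prime k).Prime := Nat.nth_mem_of_infinite Nat.infinite_setOf_prime k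
  have hmono : (Nat.nth Nat.Prime k : ℝ) ≤ Nat.nth Nat.Prime B := by
    exact_mod_cast Nat.nth_monotone Nat.infinite_setOf_prime hkB
  have hstep : ENNReal.ofReal (2 * Real.pi / (6 * ((Nat.nth Nat.Prime B : ℝ) + 1)) ^ 2) ≤
      ENNReal.ofReal (2 * Real.pi / (6 * ((Nat.nth Nat.Prime k : ℝ) + 1)) ^ 2) := by
    refine ENNReal.ofReal_le_ofReal (div_le_div_of_nonneg_left (by positivity) (by positivity) ?_)
    gcongr
  exact hstep.trans (nb_lintegral_ge_of_prime_index_free a hprime hk)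


end Summit.RiemannHypothesis.RiemannHypothesis.Theorems.Splittings.NbPlateauLock
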